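import Summits.ResolutionOfSingularities.ResolutionOfSingularities.Theorems.WeightedInvariantIdealSheafLocalModelsRees
import Summits.ResolutionOfSingularities.ResolutionOfSingularities.Theorems.WeightedInvariantELadderTwoGenericOffSupport
import Summits.ResolutionOfSingularities.ResolutionOfSingularities.Theorems.WeightedInvariantRegularSubschemeCentre
import HarnessLib

/-!
# E-ladder rung `e = 2`, centre piece (C-c): the canonical centre from a finite family of weighted MODEL CHARTS

[OURS · L1 W4.3 · DOOR `HypersurfaceCentreConstruction` (stmt-ResolutionOfSingularities-19897) · E2 CENTRE piece (C-c), scheme hand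
(o47-c-scheme), steps (G-2)…(G-5) of the registrar's DESIGN MEMO `L/res-L1-w43-plan-1/E2-CENTRE-GLUE-DESIGN-v0.md` at the SCHEME level;
written by res-D-pv-048 (gen 11).  Def-free `∃`-statement; `--supports` the door item as a helper.  OURS bookkeeping of the E-ladder,
NOT a statement of [Hironaka2017]; AI work, weaker than expert review.]

* `Stage.exists_isCanonicalCentre₂_of_modelCharts` — INPUT: a stage `S`, readings `(ι, J)`, and a FINITE family of weighted model
  charts: sections `h ℓ` of atlas charts `W (a ℓ)`, parameters `U ℓ : Fin (N ℓ) → Γ(Y, W (a ℓ))` with positive weights, such that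
  (cov) the model opens `D(h ℓ)` cover `M := closure (maxLocus₂ ι)`; (agree) the models `𝒥_m(U ℓ, w ℓ) · 𝒪_{Y,y}` agree on the
  overlaps; (J) at the points of `maxLocus₂ ι` the model stalk is the canonical filtration `J(𝒪_{Y,η}, f_η)_m`; (Z) the common zeros of
  `U ℓ` on `D(h ℓ)` lie in `M`, and (Z') the points of `maxLocus₂ ι ∩ D(h ℓ)` are common zeros; (reg) at every common zero the germs of
  `U ℓ` are linearly independent in the cotangent space.  OUTPUT: `∃ R : ReesAlgebraData S.Y` with `S.IsCanonicalCentre₂ ι J R`,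
  `R.IsRegularWeightedCentre`, `R.support ⊆ singImage S.i.ker`, the chart description `R_m(D(h ℓ)) = 𝒥_m(U ℓ, w ℓ) · Γ(D(h ℓ))`
  and degreewise maximality (the glued sheaf of `LocalModelSheaf.exists_reesAlgebraData_of_localModels`).
  The (hom) clause of admissibility is NOT addressed here ((G-6), a separate hand).
-/

noncomputable section

set_option linter.dupNamespace false
-- `Γ(Y, U)` versus `Y.presheaf.obj (op U)` inside `rw` motives (as in `…WeightedThesisTowerGenericQuotient`):
set_option backward.isDefEq.respectTransparency false

open CategoryTheory AlgebraicGeometry TopologicalSpace IsLocalRing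
open Literature.AlgebraicGeometry.Resolution
open Summit.ResolutionOfSingularities.ResolutionOfSingularities.Theorems
open Summit.ResolutionOfSingularities.ResolutionOfSingularities.Cruxes.HypersurfaceCentreConstruction.LocalEngine

namespace Summit.ResolutionOfSingularities.ResolutionOfSingularities.Theorems.ELadderOne.Stage

variable {k : Type} [Field k] (S : Stage k)

/-! ## Elementary bookkeeping on weighted monomial ideals (local copies; cf. `E2Model` of …E2ModelPrimary) -/

section Monomial

variable {A : Type} [CommRing A] {N : ℕ} (u : Fin N → A) (w : Fin N → ℕ)

/-- `𝒥ₙ(u, w) · B = 𝒥ₙ(φ ∘ u, w)` along a ring map. [folklore] -/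
private theorem map_wMI (B : Type) [CommRing B] (φ : A →+* B) (n : ℕ) :
    (weightedMonomialIdeal u w n).map φ = weightedMonomialIdeal (⇑φ ∘ u) w n := by
  unfold weightedMonomialIdeal
  rw [Ideal.map_span]
  congr 1
  ext x
  constructor
  · rintro ⟨_, ⟨α, hα, rfl⟩, rfl⟩
    exact ⟨α, hα, by simp [map_prod, map_pow]⟩
  · rintro ⟨α, hα, rfl⟩
    exact ⟨∏ i, u i ^ α i, ⟨α, hα, rfl⟩, by simp [map_prod, map_pow]⟩

/-- `uᵢ ^ n ∈ 𝒥ₙ` when `wᵢ > 0`. [folklore] -/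
private theorem pow_mem_wMI (i : Fin N) (hwi : 0 < w i) (n : ℕ) : u i ^ n ∈ weightedMonomialIdeal u w n := by
  classical
  refine Ideal.subset_span ⟨Pi.single i n, ?_, ?_⟩
  · calc n ≤ w i * n := Nat.le_mul_of_pos_left n hwi
      _ = ∑ j, w j * (Pi.single i n : Fin N → ℕ) j := by
          rw [Finset.sum_eq_single i]
          · simp
          · intro j _ hj; simp [Pi.single_eq_of_ne hj]
          · intro h; exact absurd (Finset.mem_univ i) h
  · rw [Finset.prod_eq_single i]
    · simp
    · intro j _ hj; simp [Pi.single_eq_of_ne hj]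
    · intro h; exact absurd (Finset.mem_univ i) h

/-- For `n ≥ 1`, `𝒥ₙ ≤ (u)`. [folklore] -/
private theorem wMI_le_span_range {n : ℕ} (hn : 1 ≤ n) : weightedMonomialIdeal u w n ≤ Ideal.span (Set.range u) := by
  unfold weightedMonomialIdeal
  refine Ideal.span_le.mpr ?_
  rintro x ⟨α, hα, rfl⟩
  have hex : ∃ i, 0 < α i := by
    by_contra h
    simp only [not_exists, not_lt, Nat.le_zero] at h
    have : ∑ i, w i * α i = 0 := Finset.sum_eq_zero fun i _ => by simp [h i]
    omega
  obtain ⟨i, hi⟩ := hex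
  have hdvd : u i ∣ ∏ j, u j ^ α j :=
    (dvd_pow_self (u i) hi.ne').trans (Finset.dvd_prod_of_mem (fun j => u j ^ α j) (Finset.mem_univ i))
  exact Ideal.mem_of_dvd _ hdvd (Ideal.subset_span ⟨i, rfl⟩)

end Monomial


/-- The ambient `Y` of a stage is quasi-separated (it is separated over `Spec k`). [folklore] -/
theorem quasiSeparatedSpace_Y : QuasiSeparatedSpace S.Y :=
  quasiSeparatedSpace_of_quasiSeparated S.f

/-- **THE CANONICAL e = 2 CENTRE FROM A FINITE FAMILY OF WEIGHTED MODEL CHARTS** (see the module docstring): gluing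
(`LocalModelSheaf.exists_reesAlgebraData_of_localModels`), support / stalks (`IsCanonicalCentre₂`), regular weighted charts
(`IsRegularWeightedCentre`: the model charts on `⋃ D(h ℓ) ⊇ M`, the unit chart `(V, 1)` off `M`), and `supp R = M ⊆ singImage`.
[folklore] -/
theorem exists_isCanonicalCentre₂_of_modelCharts (ι : (R : Type) → [CommRing R] → R → Ordinal.{0})
    (J : (R : Type) → [CommRing R] → R → ℕ → Ideal R) {L : Type} [Fintype L]
    (a : L → S.atlas.ι) (h : ∀ ℓ, Γ(S.Y, S.atlas.W (a ℓ))) (N : L → ℕ)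
    (U : ∀ ℓ, Fin (N ℓ) → Γ(S.Y, S.atlas.W (a ℓ))) (w : ∀ ℓ, Fin (N ℓ) → ℕ) (hw : ∀ ℓ i, 0 < w ℓ i)
    (hcov : closure (S.maxLocus₂ ι) ⊆ ⋃ ℓ, (S.Y.basicOpen (h ℓ) : Set S.Y))
    (hagree : ∀ (ℓ ℓ' : L) (m : ℕ) (y : S.Y) (hy : y ∈ S.Y.basicOpen (h ℓ)) (hy' : y ∈ S.Y.basicOpen (h ℓ')),
      (weightedMonomialIdeal (U ℓ) (w ℓ) m).map
          (S.Y.presheaf.germ (S.atlas.W (a ℓ)) y (S.Y.basicOpen_le (h ℓ) hy)).hom =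
        (weightedMonomialIdeal (U ℓ') (w ℓ') m).map
          (S.Y.presheaf.germ (S.atlas.W (a ℓ')) y (S.Y.basicOpen_le (h ℓ') hy')).hom)
    (hJ : ∀ (ℓ : L) (η : S.Y), η ∈ S.maxLocus₂ ι → ∀ (hη : η ∈ S.Y.basicOpen (h ℓ)) (m : ℕ),
      (weightedMonomialIdeal (U ℓ) (w ℓ) m).map
          (S.Y.presheaf.germ (S.atlas.W (a ℓ)) η (S.Y.basicOpen_le (h ℓ) hη)).hom =
        J (S.Y.presheaf.stalk η) (localGenerator S.i.ker η) m)
    (hZ : ∀ (ℓ : L) (y : S.Y) (hy : y ∈ S.Y.basicOpen (h ℓ)),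
      (∀ i, (S.Y.presheaf.germ (S.atlas.W (a ℓ)) y (S.Y.basicOpen_le (h ℓ) hy)).hom (U ℓ i) ∈
        maximalIdeal (S.Y.presheaf.stalk y)) → y ∈ closure (S.maxLocus₂ ι))
    (hZ' : ∀ (ℓ : L) (η : S.Y), η ∈ S.maxLocus₂ ι → ∀ (hη : η ∈ S.Y.basicOpen (h ℓ)) (i : Fin (N ℓ)),
      (S.Y.presheaf.germ (S.atlas.W (a ℓ)) η (S.Y.basicOpen_le (h ℓ) hη)).hom (U ℓ i) ∈
        maximalIdeal (S.Y.presheaf.stalk η))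
    (hreg : ∀ (ℓ : L) (y : S.Y) (hy : y ∈ S.Y.basicOpen (h ℓ))
      (hU : ∀ i, (S.Y.presheaf.germ (S.atlas.W (a ℓ)) y (S.Y.basicOpen_le (h ℓ) hy)).hom (U ℓ i) ∈
        maximalIdeal (S.Y.presheaf.stalk y)),
      LinearIndependent (ResidueField (S.Y.presheaf.stalk y))
        (fun i => (maximalIdeal (S.Y.presheaf.stalk y)).toCotangent ⟨_, hU i⟩)) :
    ∃ R : ReesAlgebraData S.Y,
      S.IsCanonicalCentre₂ ι J R ∧ R.IsRegularWeightedCentre ∧ R.support ⊆ singImage S.i.ker ∧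
      (∀ (ℓ : L) (m : ℕ), (R.piece m).ideal (S.Y.affineBasicOpen (h ℓ)) =
        (weightedMonomialIdeal (U ℓ) (w ℓ) m).map
          (S.Y.presheaf.map (homOfLE (S.Y.basicOpen_le (h ℓ))).op).hom) ∧
      ∀ (m : ℕ) (K : S.Y.IdealSheafData),
        (∀ ℓ, K.ideal (S.Y.affineBasicOpen (h ℓ)) ≤ (weightedMonomialIdeal (U ℓ) (w ℓ) m).map
          (S.Y.presheaf.map (homOfLE (S.Y.basicOpen_le (h ℓ))).op).hom) → K ≤ R.piece m := by
  classical
  haveI : QuasiSeparatedSpace S.Y := S.quasiSeparatedSpace_Y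
  -- the model opens and the model ideals, restricted to them
  set W' : L → S.Y.affineOpens := fun ℓ => S.Y.affineBasicOpen (h ℓ) with hW'
  set I : ∀ ℓ : L, ℕ → Ideal Γ(S.Y, W' ℓ) := fun ℓ m =>
    (weightedMonomialIdeal (U ℓ) (w ℓ) m).map (S.Y.presheaf.map (homOfLE (S.Y.basicOpen_le (h ℓ))).op).hom with hI
  set M : Set S.Y := closure (S.maxLocus₂ ι) with hM
  -- germs through the restriction are germs
  have hcomp : ∀ (ℓ : L) (y : S.Y) (hy : y ∈ S.Y.basicOpen (h ℓ)),
      (S.Y.presheaf.germ (W' ℓ : S.Y.Opens) y hy).hom.comp (S.Y.presheaf.map (homOfLE (S.Y.basicOpen_le (h ℓ))).op).hom =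
        (S.Y.presheaf.germ (S.atlas.W (a ℓ)) y (S.Y.basicOpen_le (h ℓ) hy)).hom := by
    intro ℓ y hy
    rw [← CommRingCat.hom_comp]
    exact congrArg CommRingCat.Hom.hom (S.Y.presheaf.germ_res (homOfLE (S.Y.basicOpen_le (h ℓ))) y hy)
  have hgerm : ∀ (ℓ : L) (m : ℕ) (y : S.Y) (hy : y ∈ S.Y.basicOpen (h ℓ)),
      (I ℓ m).map (S.Y.presheaf.germ (W' ℓ : S.Y.Opens) y hy).hom =
        (weightedMonomialIdeal (U ℓ) (w ℓ) m).map
          (S.Y.presheaf.germ (S.atlas.W (a ℓ)) y (S.Y.basicOpen_le (h ℓ) hy)).hom :=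
    fun ℓ m y hy => (Ideal.map_map _ _).trans
      (congrArg (fun φ : Γ(S.Y, S.atlas.W (a ℓ)) →+* S.Y.presheaf.stalk y => (weightedMonomialIdeal (U ℓ) (w ℓ) m).map φ)
        (hcomp ℓ y hy))
  have hgermU : ∀ (ℓ : L) (y : S.Y) (hy : y ∈ S.Y.basicOpen (h ℓ)) (x : Γ(S.Y, S.atlas.W (a ℓ))),
      (S.Y.presheaf.germ (W' ℓ : S.Y.Opens) y hy).hom ((S.Y.presheaf.map (homOfLE (S.Y.basicOpen_le (h ℓ))).op).hom x) =
        (S.Y.presheaf.germ (S.atlas.W (a ℓ)) y (S.Y.basicOpen_le (h ℓ) hy)).hom x :=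
    fun ℓ y hy x => RingHom.congr_fun (hcomp ℓ y hy) x
  -- the common zeros `Z ℓ` of `U ℓ` on `D(h ℓ)`: contain `M ∩ D(h ℓ)` and are contained in `M`
  have hMZ : ∀ (ℓ : L) (y : S.Y), y ∈ M → ∀ (hy : y ∈ S.Y.basicOpen (h ℓ)) (i : Fin (N ℓ)),
      (S.Y.presheaf.germ (S.atlas.W (a ℓ)) y (S.Y.basicOpen_le (h ℓ) hy)).hom (U ℓ i) ∈
        maximalIdeal (S.Y.presheaf.stalk y) := by
    intro ℓ y hyM hy i
    by_contra hunit
    rw [IsLocalRing.mem_maximalIdeal, mem_nonunits_iff, not_not] at hunit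
    have hyB : y ∈ S.Y.basicOpen (U ℓ i) := (S.Y.mem_basicOpen (U ℓ i) y (S.Y.basicOpen_le (h ℓ) hy)).mpr hunit
    -- the open `D(U ℓ i) ∩ D(h ℓ) ∋ y` meets `maxLocus₂`
    obtain ⟨η, ⟨hηB, hηh⟩, hηmax⟩ := mem_closure_iff.mp hyM _
      ((S.Y.basicOpen (U ℓ i)).2.inter (S.Y.basicOpen (h ℓ)).2) ⟨hyB, hy⟩
    have h1 := hZ' ℓ η hηmax hηh i
    rw [IsLocalRing.mem_maximalIdeal, mem_nonunits_iff] at h1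
    exact h1 ((S.Y.mem_basicOpen (U ℓ i) η (S.Y.basicOpen_le (h ℓ) hηh)).mp hηB)
  -- apply the generic gluing
  have h0 : ∀ ℓ, I ℓ 0 = ⊤ := fun ℓ => by rw [hI]; simp only [weightedMonomialIdeal_zero, Ideal.map_top]
  have hmul : ∀ ℓ m n, I ℓ m * I ℓ n ≤ I ℓ (m + n) := fun ℓ m n => by
    rw [hI, ← Ideal.map_mul]
    exact Ideal.map_mono (weightedMonomialIdeal_mul_le (U ℓ) (w ℓ) m n)
  have hagree' : ∀ (ℓ ℓ' : L) (m : ℕ) (y : S.Y) (hy : y ∈ (W' ℓ : S.Y.Opens)) (hy' : y ∈ (W' ℓ' : S.Y.Opens)),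
      (I ℓ m).map (S.Y.presheaf.germ (W' ℓ : S.Y.Opens) y hy).hom =
        (I ℓ' m).map (S.Y.presheaf.germ (W' ℓ' : S.Y.Opens) y hy').hom := fun ℓ ℓ' m y hy hy' => by
    rw [hgerm ℓ m y hy, hgerm ℓ' m y hy']
    exact hagree ℓ ℓ' m y hy hy'
  have hcov' : ∀ ℓ m, closure ((W' ℓ : Set S.Y) ∩ S.Y.zeroLocus (U := (W' ℓ : S.Y.Opens)) (I ℓ m : Set Γ(S.Y, W' ℓ))) ⊆
      ⋃ ℓ', ((W' ℓ' : S.Y.Opens) : Set S.Y) := by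
    intro ℓ m
    -- `D(h ℓ) ∩ V(I ℓ m) ⊆ M` (for `m ≥ 1` through the common zeros; empty for `m = 0`)
    have hsub : (W' ℓ : Set S.Y) ∩ S.Y.zeroLocus (U := (W' ℓ : S.Y.Opens)) (I ℓ m : Set Γ(S.Y, W' ℓ)) ⊆ M := by
      rintro y ⟨hy, hyz⟩
      rw [Scheme.mem_zeroLocus_iff] at hyz
      rcases Nat.eq_zero_or_pos m with rfl | hm
      · exfalso
        have h1 : (1 : Γ(S.Y, W' ℓ)) ∈ I ℓ 0 := by rw [h0]; trivial
        refine hyz 1 h1 ?_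
        rw [(S.Y.mem_basicOpen (1 : Γ(S.Y, W' ℓ)) y hy)]
        change IsUnit ((S.Y.presheaf.germ (W' ℓ : S.Y.Opens) y hy).hom 1)
        rw [map_one]
        exact isUnit_one
      · refine hZ ℓ y hy fun i => ?_
        by_contra hunit
        rw [IsLocalRing.mem_maximalIdeal, mem_nonunits_iff, not_not] at hunit
        have hmem : (S.Y.presheaf.map (homOfLE (S.Y.basicOpen_le (h ℓ))).op).hom (U ℓ i ^ m) ∈ I ℓ m :=
          Ideal.mem_map_of_mem _ (pow_mem_wMI (U ℓ) (w ℓ) i (hw ℓ i) m)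
        refine hyz _ hmem ?_
        rw [S.Y.mem_basicOpen _ y hy]
        change IsUnit ((S.Y.presheaf.germ (W' ℓ : S.Y.Opens) y hy).hom
          ((S.Y.presheaf.map (homOfLE (S.Y.basicOpen_le (h ℓ))).op).hom (U ℓ i ^ m)))
        rw [hgermU ℓ y hy, map_pow]
        exact hunit.pow m
    exact ((closure_mono hsub).trans (by rw [hM, closure_closure])).trans hcov
  obtain ⟨R, hst, hoff, hsec, hmax⟩ :=
    LocalModelSheaf.exists_reesAlgebraData_of_localModels W' I h0 hmul hagree' hcov'
  -- stalks on the model opens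
  have hstalk : ∀ (ℓ : L) (m : ℕ) (y : S.Y) (hy : y ∈ S.Y.basicOpen (h ℓ)), stalkIdeal (R.piece m) y =
      (weightedMonomialIdeal (U ℓ) (w ℓ) m).map (S.Y.presheaf.germ (S.atlas.W (a ℓ)) y (S.Y.basicOpen_le (h ℓ) hy)).hom :=
    fun ℓ m y hy => by rw [hst ℓ m y hy, hgerm ℓ m y hy]
  -- stalks off `M` are `⊤`
  have htop : ∀ y : S.Y, y ∉ M → ∀ m, stalkIdeal (R.piece m) y = ⊤ := by
    intro y hyM m
    by_cases hex : ∃ ℓ, y ∈ S.Y.basicOpen (h ℓ)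
    · obtain ⟨ℓ, hy⟩ := hex
      rw [hstalk ℓ m y hy]
      -- some parameter is a unit at `y` (else `y ∈ Z ℓ ⊆ M`)
      by_contra hne
      apply hyM
      refine hZ ℓ y hy fun i => ?_
      by_contra hunit
      rw [IsLocalRing.mem_maximalIdeal, mem_nonunits_iff, not_not] at hunit
      refine hne (Ideal.eq_top_of_isUnit_mem _
        (Ideal.mem_map_of_mem _ (pow_mem_wMI (U ℓ) (w ℓ) i (hw ℓ i) m)) ?_)
      rw [map_pow]
      exact hunit.pow m
    · push Not at hex
      exact hoff m y fun ℓ => hex ℓ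
  -- stalks on `M` lie in the maximal ideal, for `m ≥ 1`
  have hprop : ∀ y : S.Y, y ∈ M → ∀ m, 0 < m → stalkIdeal (R.piece m) y ≤ maximalIdeal (S.Y.presheaf.stalk y) := by
    intro y hyM m hm
    obtain ⟨ℓ, hy⟩ := Set.mem_iUnion.mp (hcov hyM)
    rw [hstalk ℓ m y hy, Ideal.map_le_iff_le_comap]
    refine (wMI_le_span_range (U ℓ) (w ℓ) hm).trans ?_
    rw [Ideal.span_le]
    rintro _ ⟨i, rfl⟩
    exact hMZ ℓ y hyM hy i
  have hsupp : R.support = M := by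
    ext y
    rw [ReesAlgebraData.mem_support_iff]
    constructor
    · intro hy
      by_contra hyM
      have h1 := (mem_support_iff_stalkIdeal_le _ y).mp (hy 1 one_pos)
      rw [htop y hyM 1] at h1
      exact (IsLocalRing.maximalIdeal.isMaximal _).ne_top (top_le_iff.mp h1)
    · intro hyM n hn
      exact (mem_support_iff_stalkIdeal_le _ y).mpr (hprop y hyM n hn)
  refine ⟨R, ⟨hsupp, fun η hη n => ?_, fun y hy n => htop y hy n⟩, fun y => ?_, ?_, fun ℓ m => hsec ℓ m, fun m K hK => hmax m K hK⟩
  · -- stalks on the maximum locus: the canonical filtration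
    obtain ⟨ℓ, hηℓ⟩ := Set.mem_iUnion.mp (hcov (subset_closure hη))
    rw [hstalk ℓ n η hηℓ]
    exact hJ ℓ η hη hηℓ n
  · -- regular weighted charts
    by_cases hex : ∃ ℓ, y ∈ S.Y.basicOpen (h ℓ)
    · obtain ⟨ℓ, hy⟩ := hex
      refine ⟨W' ℓ, hy, N ℓ, fun i => (S.Y.presheaf.map (homOfLE (S.Y.basicOpen_le (h ℓ))).op).hom (U ℓ i), w ℓ,
        ⟨hw ℓ, fun n => ?_, fun y' hy' hU' => ?_⟩⟩
      · rw [hsec ℓ n]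
        show (weightedMonomialIdeal (U ℓ) (w ℓ) n).map _ = _
        rw [map_wMI]
        rfl
      · have hU'' : ∀ i, (S.Y.presheaf.germ (S.atlas.W (a ℓ)) y' (S.Y.basicOpen_le (h ℓ) hy')).hom (U ℓ i) ∈
            maximalIdeal (S.Y.presheaf.stalk y') := fun i => (hgermU ℓ y' hy' (U ℓ i)) ▸ hU' i
        convert hreg ℓ y' hy' hU'' using 2 with i
        exact congrArg _ (Subtype.ext (hgermU ℓ y' hy' (U ℓ i)))
    · -- off the model opens: `y ∉ M`; the unit chart on an affine neighbourhood missing `M`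
      push Not at hex
      have hyM : y ∉ M := fun hyM => by
        obtain ⟨ℓ, hy⟩ := Set.mem_iUnion.mp (hcov hyM)
        exact hex ℓ hy
      have hopen : IsOpen Mᶜ := by rw [hM]; exact isClosed_closure.isOpen_compl
      obtain ⟨V, hV, hyV, hVM⟩ := exists_isAffineOpen_mem_and_subset (X := S.Y) (x := y) (U := ⟨Mᶜ, hopen⟩) hyM
      refine ⟨⟨V, hV⟩, hyV, 1, fun _ => 1, fun _ => 1, ⟨fun _ => one_pos, fun n => ?_, fun y' hy' hU' => ?_⟩⟩
      · -- both sides are the unit ideal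
        have hr : weightedMonomialIdeal (fun _ : Fin 1 => (1 : Γ(S.Y, V))) (fun _ => 1) n = ⊤ :=
          Ideal.eq_top_of_isUnit_mem _
            (pow_mem_wMI (fun _ : Fin 1 => (1 : Γ(S.Y, V))) (fun _ => 1) 0 one_pos n)
            (by rw [one_pow]; exact isUnit_one)
        rw [hr, Ideal.eq_top_iff_one, mem_ideal_iff_forall_germ_mem_stalkIdeal]
        intro y' hy'
        rw [htop y' (fun h' => hVM hy' h') n]
        trivial
      · exfalso
        have h1 := hU' 0
        rw [map_one] at h1
        exact (IsLocalRing.maximalIdeal.isMaximal _).ne_top ((Ideal.eq_top_iff_one _).mpr h1)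
  · -- support inside the non-regular image
    rw [hsupp, hM]
    exact S.closure_maxLocus₂_subset_singImage ι

end Summit.ResolutionOfSingularities.ResolutionOfSingularities.Theorems.ELadderOne.Stage

end
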